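import Summits.QuantumFields.YangMills.Theorems.BalabanLadderIRColdPressurePincer
import Summits.QuantumFields.YangMills.Theorems.PencilRigidityWeakCouplingHypercubicLimitStubRpSpectralOfColdPressure
import Summits.QuantumFields.YangMills.Theorems.GapAtCorrelationLength.Negative.GapAtCorrelationLengthFalseOfLightFluxGroup
import HarnessLib

/-!
# `¬ ColdPressureOnset` modulo a light magnetic flux mode (the π₁-EXPOSURE of the periodic free-energy currency)

Target: the stub statement `ColdPressurePincer.ColdPressureOnset` (I_cp) of the crux-idea card `Cruxes/IR/Ideas/ym19354-5-cold-pressure-pincer.md` (seat `ym-cruxidea-19354-5` gen 2; sketch of record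
`Sketch-g2.lean` sha16 `d0296864a2f25cb8`, evidence #49 on stmt-QuantumFields-19354), landed as helper modules per the route
owner's LANDABLE-NOW list R19 (8) «cold-pressure seams … as idle work» (ym-beyond-p2 g24) by ★ym-osasm-p1 g7, `--supports
stmt-QuantumFields-19354` (helper; no registered stub of 19354 is claimed — the slot of record is `af-pincer-T`).

Findings (kernel-checked; every compact `G`, no simplicity used):
* `lightFlux_budget_eventually` — eventually `e^{−gS/4} + 16 C₀ (2S+1)³ e^{−g·3S/4} < e^{−(g/8)S}`.
* `coldPressureOnsetAt_false_of_lightFluxMode` — `LightFluxMode G` (tree, `GapAtCorrelationLength.Negative`, the hypothesis of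
  W₁'s landed negative lemma; physics-certain at `SO(3)`: 't Hooft's light ℤ₂ magnetic flux in the confined phase — at every
  large `β`, beyond every size, some unit-bounded slab functional has reflected time-`n` covariance `≥ e^{−εS}` with `S ≤ 4n`)
  refutes a cold-pressure onset at every faithful `r`: the landed `TraceNormColdPressure.stub_rpSpectralOfColdPressure` turns
  per-β cold pressure at rate `g = 1/ξ` into covariance `≤ e^{−g n} + 16 C₀ (2S+1)³ e^{−3gS/4} < e^{−gS/8}` for large `S` —
  contradiction at `ε = g/8`.
* `not_coldPressureOnset_of_lightFluxMode_SO3 : LightFluxMode SO(3) → ¬ ColdPressureOnset` (`SO(3)` is admissible: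
  `isCompactSimpleLieGroup_SO3`, `nonempty_latticeRep_SO3`).

Reading: the periodic free-energy currency COUNTS the `|π₁(G)|³` light magnetic-flux vacua, so stub I_cp as typed over all
simple `G` is false modulo a physics-certain hypothesis; `IR` itself (separations capped `n ≤ S`, local observables) and
af-pincer's TV∕DLR stub I (finite regions with boundary data carry no flux sectors) are NOT hit.  The repair is the
simply-connected split (`ColdPressurePincer.IR_of_cp_repaired`) plus the `q`-level light-code currency for `IRnsc`
(`FluxCodeBlindness.IR_of_lightCodePincer`).  Precedent: `Negative/ColdPressureAtLockVersusLatticeLeg` (15915).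
HONEST FRAMING: a conditional negative lemma (hypothesis `LightFluxMode`, not constructed here); not a refutation of `IR`.

Refs: card; 't Hooft, Nucl. Phys. B153 (1979); Greensite, *An Introduction to the Confinement Problem* (2011) (4.47);
Osterwalder–Seiler, Ann. Phys. 110 (1978) §3.
-/

set_option autoImplicit false

noncomputable section

open Filter Topology MeasureTheory
open scoped SchwartzMap
open Literature.MathematicalPhysics.QuantumFieldTheory Literature.MathematicalPhysics.QuantumLattice
open Summit.QuantumFields.YangMills.Cruxes.OSLegsFromFemtoAndGap.DlrCollarTransfer (GapInUnits LowerBounds Q2)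
open Literature.MathematicalPhysics.QuantumFieldTheory.Balaban1983to89.Sufficient (ColdPressureBound)
open Summit.QuantumFields.YangMills.Cruxes.IR.FluxCodeBlindness (volumeFloor_eventually)

namespace Summit.QuantumFields.YangMills.Cruxes.IR.ColdPressurePincer

section LightFlux

open Summit.QuantumFields.YangMills.Theorems.GapAtCorrelationLength.Negative (LightFluxMode)
open Literature.AlgebraicTopology.FundamentalGroup (SO3)
open Summit.QuantumFields.YangMills.Theorems.NonSimplyConnectedLatticeGap
  (so3_isTopologicalGroup so3_compactSpace isCompactSimpleLieGroup_SO3 nonempty_latticeRep_SO3)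

/-- Budget: eventually `e^{−gS/4} + 16 C₀ (2S+1)³ e^{−g·3S/4} < e^{−(g/8)S}`. [folklore] -/
theorem lightFlux_budget_eventually (C₀ g : ℝ) (hC₀ : 0 ≤ C₀) (hg : 0 < g) :
    ∀ᶠ S : ℕ in atTop,
      Real.exp (-(g * S / 4)) + 16 * C₀ * ((2 * S + 1 : ℕ) : ℝ) ^ 3 * Real.exp (-(g * (3 * (S : ℝ) / 4))) <
        Real.exp (-(g / 8 * S)) := by
  have h1 := volumeFloor_eventually (16 * C₀) g (by positivity) hg
  have h2 : ∀ᶠ S : ℕ in atTop, 8 * Real.log 3 / g < (S : ℝ) :=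
    tendsto_natCast_atTop_atTop.eventually_gt_atTop _
  filter_upwards [h1, h2] with S hS1 hS2
  have hA : 16 * C₀ * ((2 * S + 1 : ℕ) : ℝ) ^ 3 * Real.exp (-(g * (3 * (S : ℝ) / 4))) ≤
      Real.exp (-(g * S / 4)) := by
    have hsplit : Real.exp (-(g * (3 * (S : ℝ) / 4))) = Real.exp (-(g * S / 2)) * Real.exp (-(g * S / 4)) := by
      rw [← Real.exp_add]; congr 1; ring
    rw [hsplit, ← mul_assoc]
    calc 16 * C₀ * ((2 * S + 1 : ℕ) : ℝ) ^ 3 * Real.exp (-(g * S / 2)) * Real.exp (-(g * S / 4))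
        ≤ 1 * Real.exp (-(g * S / 4)) := mul_le_mul_of_nonneg_right hS1 (Real.exp_nonneg _)
      _ = Real.exp (-(g * S / 4)) := one_mul _
  have hB : 2 * Real.exp (-(g * S / 4)) < Real.exp (-(g / 8 * S)) := by
    have hlog : Real.log 3 < g / 8 * S := by
      have h := (div_lt_iff₀ hg).1 hS2
      have : g / 8 * (S : ℝ) = S * g / 8 := by ring
      rw [this]; linarith
    have h3 : (3 : ℝ) < Real.exp (g / 8 * S) := by
      calc (3 : ℝ) = Real.exp (Real.log 3) := (Real.exp_log (by norm_num)).symm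
        _ < Real.exp (g / 8 * S) := Real.exp_lt_exp.2 hlog
    have hsplit : Real.exp (-(g * S / 4)) = Real.exp (-(g / 8 * S)) * Real.exp (-(g / 8 * S)) := by
      rw [← Real.exp_add]; congr 1; ring
    have hpos : 0 < Real.exp (-(g / 8 * S)) := Real.exp_pos _
    have hinv : Real.exp (-(g / 8 * S)) * Real.exp (g / 8 * S) = 1 := by
      rw [← Real.exp_add]; simp
    have hsmall : 2 * Real.exp (-(g / 8 * S)) < 1 := by nlinarith [hinv, h3, hpos]
    rw [hsplit]; nlinarith [hsmall, hpos]
  linarith [hA, hB, Real.exp_nonneg (-(g * (S : ℝ) / 4))]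

/-- **Light flux kills per-β cold pressure (PROVED, every compact `G`, no simplicity used).**  If `G` has a light-flux
mode then no faithful `r` admits a cold-pressure onset: `¬ ∃ β₂, ∀ β ≥ β₂, ∃ ξ ≥ 1, ColdPressureAt r.ρ β ξ`.
Bookkeeping over the landed `stub_rpSpectralOfColdPressure` (p129909) with `B = 1`, `g' = g = 1/ξ`, `ε = g/8` and the
budget lemma. [folklore] -/
theorem coldPressureOnsetAt_false_of_lightFluxMode
    (G : Type) [Group G] [TopologicalSpace G] [IsTopologicalGroup G] [CompactSpace G] (hLF : LightFluxMode G) :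
    letI : MeasurableSpace G := borel G
    haveI : BorelSpace G := ⟨rfl⟩
    ∀ r : LatticeRep G, ¬ ∃ β₂ : ℝ, ∀ β : ℝ, β₂ ≤ β → ∃ ξ : ℕ, 1 ≤ ξ ∧ ColdPressureAt r.ρ β ξ := by
  letI : MeasurableSpace G := borel G
  haveI : BorelSpace G := ⟨rfl⟩
  intro r hon
  obtain ⟨β₂, hcp⟩ := hon
  obtain ⟨β₃, hβ₃⟩ := Filter.eventually_atTop.1 (hLF r)
  set β : ℝ := max (max β₂ β₃) 0 with hβ_def
  have hβ2 : β₂ ≤ β := (le_max_left _ _).trans (le_max_left _ _)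
  have hβ3 : β₃ ≤ β := (le_max_right _ _).trans (le_max_left _ _)
  have hβ0 : 0 ≤ β := le_max_right _ _
  obtain ⟨ξ, hξ, C₀, S₁, hC₀, hP⟩ := hcp β hβ2
  set g : ℝ := 1 / (ξ : ℝ) with hg_def
  have hξpos : (0 : ℝ) < (ξ : ℝ) := by exact_mod_cast hξ
  have hg : 0 < g := by rw [hg_def]; positivity
  obtain ⟨S₂, hS₂⟩ := Filter.eventually_atTop.1 (lightFlux_budget_eventually C₀ g hC₀ hg)
  obtain ⟨S, T, n, hSM, hgeom, hS4n, Y, hYm, hYb, hYd, hcov⟩ :=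
    hβ₃ β hβ3 (g / 8) (by positivity) (max S₁ S₂)
  have hS1 : S₁ ≤ S := (le_max_left _ _).trans hSM
  have hS2 : S₂ ≤ S := (le_max_right _ _).trans hSM
  haveI : SecondCountableTopology G :=
    (r.continuous.isClosedEmbedding r.injective).isEmbedding.secondCountableTopology
  haveI := isProbabilityMeasure_wilsonMeasure (d := 4) (L := 2 * S + 1) r.ρ r.continuous β
  -- the landed RP-spectral consequence of cold pressure, at `B = 1`, `g' = g`
  have hP' : ∀ S : ℕ, S₁ ≤ S → ∀ m : ℕ, S + 1 ≤ 2 * (m + 2) →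
      traceExcess r.ρ β (2 * S + 1) (m + 2) ≤
        C₀ * ((2 * S + 1 : ℕ) : ℝ) ^ 3 * Real.exp (-(g * ((m + 2 : ℕ) : ℝ))) :=
    fun S hS m hm => hP S hS m hm
  have hRP := Summit.QuantumFields.YangMills.Theorems.WeakCouplingHypercubicLimit.TraceNormColdPressure.stub_rpSpectralOfColdPressure
    G r β hβ0 g C₀ S₁ hg.le hC₀ hP' S T n hS1 hgeom Y 1 hYm hYb hYd
    g hg.le le_rfl
  -- `⟨ΘY·Y⟩ ≤ 1`
  have hI2 : (∫ U, Y (torusLift (2 * S + 1) (GaugeConfig.timeReflect U)) * Y (torusLift (2 * S + 1) U)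
        ∂(wilsonMeasure r.ρ β : Measure (GaugeConfig 4 (2 * S + 1) G))) ≤ 1 := by
    have h := norm_integral_le_of_norm_le_const
      (μ := (wilsonMeasure r.ρ β : Measure (GaugeConfig 4 (2 * S + 1) G)))
      (f := fun U => Y (torusLift (2 * S + 1) (GaugeConfig.timeReflect U)) * Y (torusLift (2 * S + 1) U))
      (C := 1) (Eventually.of_forall fun U => by
        rw [Real.norm_eq_abs, abs_mul]
        calc |Y (torusLift (2 * S + 1) (GaugeConfig.timeReflect U))| * |Y (torusLift (2 * S + 1) U)|
            ≤ 1 * 1 := mul_le_mul (hYb _) (hYb _) (abs_nonneg _) zero_le_one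
          _ = 1 := one_mul _)
    have h' := (le_abs_self _).trans (by simpa [Real.norm_eq_abs] using h)
    exact h'
  have hvar : (∫ U, Y (torusLift (2 * S + 1) (GaugeConfig.timeReflect U)) * Y (torusLift (2 * S + 1) U)
        ∂(wilsonMeasure r.ρ β : Measure (GaugeConfig 4 (2 * S + 1) G))) -
      (∫ U, Y (torusLift (2 * S + 1) U) ∂(wilsonMeasure r.ρ β : Measure (GaugeConfig 4 (2 * S + 1) G))) ^ 2 ≤ 1 := by
    nlinarith [hI2, sq_nonneg (∫ U, Y (torusLift (2 * S + 1) U)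
      ∂(wilsonMeasure r.ρ β : Measure (GaugeConfig 4 (2 * S + 1) G)))]
  -- `e^{-g n} ≤ e^{-g S/4}` from `S ≤ 4 n`
  have hn : Real.exp (-(g * n)) ≤ Real.exp (-(g * S / 4)) := by
    apply Real.exp_le_exp.2
    have : (S : ℝ) ≤ 4 * (n : ℝ) := by exact_mod_cast hS4n
    nlinarith [hg]
  have hbudget := hS₂ S hS2
  have hup := (le_abs_self _).trans hRP
  have h1 : Real.exp (-(g * n)) *
      ((∫ U, Y (torusLift (2 * S + 1) (GaugeConfig.timeReflect U)) * Y (torusLift (2 * S + 1) U)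
          ∂(wilsonMeasure r.ρ β : Measure (GaugeConfig 4 (2 * S + 1) G))) -
        (∫ U, Y (torusLift (2 * S + 1) U) ∂(wilsonMeasure r.ρ β : Measure (GaugeConfig 4 (2 * S + 1) G))) ^ 2)
      ≤ Real.exp (-(g * S / 4)) := by
    calc _ ≤ Real.exp (-(g * n)) * 1 :=
          mul_le_mul_of_nonneg_left hvar (Real.exp_nonneg _)
      _ ≤ Real.exp (-(g * S / 4)) := by rw [mul_one]; exact hn
  have h16 : 16 * C₀ * ((2 * S + 1 : ℕ) : ℝ) ^ 3 * Real.exp (-(g * (3 * (S : ℝ) / 4))) * (1 : ℝ) ^ 2 =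
      16 * C₀ * ((2 * S + 1 : ℕ) : ℝ) ^ 3 * Real.exp (-(g * (3 * (S : ℝ) / 4))) := by ring
  rw [h16] at hup
  linarith [hcov, hup, h1, hbudget]

/-- **At `SO(3)` (admissible): `LightFluxMode SO(3) → ¬ ColdPressureOnset`.**  The stub I_cp AS TYPED OVER ALL SIMPLE
`G` is false modulo the physics-certain light ℤ₂ flux of `SO(3)` — the −9 sieve's «too narrow at SO(3)» verdict,
here a kernel implication. [folklore] -/
theorem not_coldPressureOnset_of_lightFluxMode_SO3
    (hH : @LightFluxMode SO3 _ _ so3_isTopologicalGroup so3_compactSpace) : ¬ ColdPressureOnset := by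
  intro hI
  have h := @coldPressureOnsetAt_false_of_lightFluxMode SO3 _ _ so3_isTopologicalGroup so3_compactSpace hH
  have hI' := @hI SO3 _ _ so3_isTopologicalGroup so3_compactSpace isCompactSimpleLieGroup_SO3
  -- a faithful lattice representation of `SO(3)` exists (tree: `nonempty_latticeRep_SO3`)
  obtain ⟨r⟩ := nonempty_latticeRep_SO3
  exact h r (hI' r)

end LightFlux

end Summit.QuantumFields.YangMills.Cruxes.IR.ColdPressurePincer

end
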